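import Summits.QuantumFields.BalabanUV.T4Continuum.Support.OutputRateComplexSliceEntrywise
import Summits.QuantumFields.BalabanUV.T4Continuum.Support.OutputRateComplexSliceWitness

/-!
# OutputRateComplexSliceLetters — W1-real ON THE RELATED WINDOW FROM LETTER DATA (the letter road; scope per rulings R52∕R53), and the kernel
# witness that INDEPENDENT two-run pair coordinates admit no rate (ruling R52 (2))

Cell `pub-balaban`, unit `b2b-balaban-t4-ne5-p1` (row NE5 OWNER, gen 37; owner item «g37-a», rulings R52 `HOME/CLAIMS.log` l.19485 and R53 l.19772; answers the
located typing point of `b2b-balaban-substrate-p1` gen 5, INTENT `SubstrateChartRelatedPair` l.19346 «the section of record is a RELATED pair»).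
Summits-side NEW WORK under the LEAN PLACEMENT RULE ([folklore] composition over ABSTRACT entry sets, letter spaces and background types + one toy
witness; nothing printed is asserted; no `[cite:]`; no `Prop`-valued fact minted; 0 `def`).  HONEST FRAMING: rung (B)+1 of the FINITE-VOLUME T⁴
continuum programme — NOT infinite volume, NOT a mass gap, NOT the Clay problem, NOT a proof of NE5 (NOT PRINTED; GAPS G-t4-U3-1), NOT a proof of
NE2 or NE3.  HONEST DEPENDENCY (cell, verbatim): continuum YM on T⁴ ⇐ BetaPertH ∧ nine spine estimates (0/9 proved); BetaPertH ⇐ (D1) ∧ (D4) ∧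
CAP+tail; G-an2-4 gates asym, D1 and NE2/3/4.

WHY.  The typed target `T4OutputRate.NE5` compares the two runs at ONE background variable (`EA g (C.transport U) X` vs `EB g U X`), and W1 OF
RECORD (`B13ReadingsRecord`, RULE R4) reads run A through the transport; the substrate's `sectionOfRecord_eq_relPair` (W-20 ∕ L-E14) makes run A's
tower the restriction `resA` of run B's.  So the real window of Road D is a window of RELATED pairs (R52 (1)); §3 below is R52 (2) as a kernel fact:
on a window of INDEPENDENT pair coordinates (run A's and run B's backgrounds varied separately) even 1-Lipschitz level-constant families that AGREE
on the related diagonal admit NO pair `(δ, θ < 1)` — the zeroth-order term `oA(T_A) − oA(resA T_B)` has no `θ^k` — so a pair-window `real` of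
independent pairs cannot be a socket.  §1–§2 type the LETTER road to the W1-real socket of `OutputRateComplexSliceEntrywise` (§1 `hreal`, §3
`hwer`): wherever a species of both runs is ONE functional `Φ k ℓ` of a LETTER at a fixed real object, W1-real for it FACTORS as LETTER-LIPSCHITZ
(`Φ k` against the format weight) × LETTER-RATE (the two runs' letters at aligned steps `C_ℓ·rate k`-close), and a letter rate comes from a
CONTRACTING letter recursion run from different initial letters (§1b).  SCOPE (ruling R53, which CORRECTS R52 (3)): the W1 readings OF RECORD for
the tower-read species are LEVEL-SHIFTED (`B13ReadingsDecay.ReadsTowerCovB` reads run B ONE LEVEL DEEPER than run A — the aligned run-B term has one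
more fine level), so the two-run difference of the covariance ∕ Green species of record is the tower's TWO-LEVEL rate at the related background
(`B13ReadingsDelta`, rows NE2 ∧ NE3's currency) — NOT zero and NOT letter arithmetic; the letter road of this file covers the LETTER-BORNE RESIDUE on
top of that shift (step-indexed scheme constants which the model identifies across runs — substrate-typer A-S17 (a′): the averaging constants
`a_k` of [Balaban1982Higgs1] (2.22)–(2.26), KIND only, nothing asserted) and any species genuinely read through letters at a common object.  Which
letters differ between the runs is A-S17's census; whether rows NE2 ∧ NE3 type their rates for tower arguments on the α′-window is Q-NE23-W′ — the
binders `hΦ` ∕ `hℓ` stay DISPLAYED, asserted by nobody.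

WHAT ([folklore]; 0 def).
* `entryRate_real_of_letters` (one level, one window; g36-c §1's `hreal` shape from letter readings `hA`∕`hB`, letter-Lipschitz `hΦ`, letter rate `hℓ`).
* `weightedEntrywiseRate_real_of_letters_rate` ∕ `…_of_letters` (all levels over a real background type `BgR`: ⟹
  `WeightedEntrywiseRate F rawAr rawBr W (Lip·C_ℓ) rate` — EXACTLY the input `hwer` of g36-c §3 at `rate k = θ^k`);
  `weightedEntrywiseRate_real_of_letters_or_rate` (mixed entry sets: letter-driven entries `e ∈ S`, the rest with a displayed rate; constant `max`).
* `letterRate_of_contraction` ∕ `_on` (where a letter rate comes from: the SAME contracting step maps from DIFFERENT initial letters ⟹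
  `dℓ (ℓA k) (ℓB k) ≤ C₀·q^k` — the binder `hℓ`).
* `weightedEntrywiseRate_complex_of_letters` (the chain BY NAME: letters on the real window + per-entry slice letters ⟹ g36-c's conclusion over the
  recursion chart at the degraded pair, + `RawBounded`).
* `independentPairs_no_rate` (R52 (2): toy on `ℝ × ℝ`, `oA v := v.1`, `oB v := v.2`; related diagonal: rate with `δ = 0`; independent unit window:
  no `(δ, θ < 1)` — `OutputRateComplexSliceWitness.no_rate_of_floor` BY NAME at the point `(1, 0)`).
0 sorry; axioms ⊆ {propext, Classical.choice, Quot.sound}.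
-/

noncomputable section

open Complex Set Metric Real

namespace Summit.QuantumFields.BalabanUV.T4Continuum.OutputRateComplexSliceLetters

open Summit.QuantumFields.BalabanUV.T4Continuum.B13OpDatum
open Summit.QuantumFields.BalabanUV.T4Continuum.B13OpDatumJunctions
open Summit.QuantumFields.BalabanUV.T4Continuum.OutputRateComplexSliceEntrywise
open Summit.QuantumFields.BalabanUV.T4Continuum.OutputRateComplexSliceWitness (no_rate_of_floor)

variable {E : Type*} {Λ : Type*} {𝒰 𝒱 : Type}

/-! ## §1 W1-real from letter data -/

/-- [folklore] **ONE LEVEL: the real-window entry rate FROM LETTER DATA.**  On `real ⊆ 𝒱` the two entry families are ONE functional `Φ` of a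
letter read at the two runs' letters (`hA`∕`hB`: `KA g k v e = Φ (ℓA g) v e`, `KB g k v e = Φ (ℓB g) v e` — a species read through a LETTER at a common
real object; scope per ruling R53 in the module docstring); `Φ` is Lipschitz in the letter against the format weight (`hΦ`, letter gauge `dℓ`, constant `Lip ≥ 0`); the
two runs' letters are `C_ℓ·θ^k`-close (`hℓ`) ⟹ g36-c §1's `hreal` with `δ = Lip·C_ℓ`. -/
theorem entryRate_real_of_letters (F : Format E) (dℓ : Λ → Λ → ℝ) {Φ : Λ → 𝒱 → E → ℂ}
    {KA KB : (ℕ → ℝ) → ℕ → 𝒱 → E → ℂ} {ℓA ℓB : (ℕ → ℝ) → Λ} {W : Set (ℕ → ℝ)} {real : Set 𝒱} {Lip Cℓ θ : ℝ} {k : ℕ}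
    (hLip : 0 ≤ Lip) (hA : ∀ g ∈ W, ∀ v ∈ real, ∀ e, KA g k v e = Φ (ℓA g) v e)
    (hB : ∀ g ∈ W, ∀ v ∈ real, ∀ e, KB g k v e = Φ (ℓB g) v e)
    (hΦ : ∀ ℓ ℓ', ∀ v ∈ real, ∀ e, ‖Φ ℓ v e - Φ ℓ' v e‖ ≤ Lip * dℓ ℓ ℓ' * F.wt e)
    (hℓ : ∀ g ∈ W, dℓ (ℓA g) (ℓB g) ≤ Cℓ * θ ^ k) :
    ∀ g ∈ W, ∀ v ∈ real, ∀ e, ‖KA g k v e - KB g k v e‖ ≤ Lip * Cℓ * θ ^ k * F.wt e := by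
  intro g hg v hv e
  rw [hA g hg v hv e, hB g hg v hv e]
  calc ‖Φ (ℓA g) v e - Φ (ℓB g) v e‖ ≤ Lip * dℓ (ℓA g) (ℓB g) * F.wt e := hΦ _ _ v hv e
    _ ≤ Lip * (Cℓ * θ ^ k) * F.wt e :=
      mul_le_mul_of_nonneg_right (mul_le_mul_of_nonneg_left (hℓ g hg) hLip) (F.wt_pos e).le
    _ = Lip * Cℓ * θ ^ k * F.wt e := by ring

/-- [folklore] **ALL LEVELS OVER A REAL BACKGROUND TYPE, GENERAL RATE: the W1 binder of record FROM LETTER DATA.**  Raw suppliers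
`rawAr rawBr : (ℕ → ℝ) → BgR → ℕ → E → ℂ` that are, level by level, ONE functional `Φ k` of a letter read at the two runs' level-`k` letters
`ℓA g k` ∕ `ℓB g k`; `Φ k` Lipschitz in the letter against `(F k).wt`; letters `C_ℓ·rate k`-close ⟹
`WeightedEntrywiseRate F rawAr rawBr W (Lip·C_ℓ) rate`. -/
theorem weightedEntrywiseRate_real_of_letters_rate (F : ℕ → Format E) {BgR : Type} (dℓ : Λ → Λ → ℝ)
    {Φ : ℕ → Λ → BgR → E → ℂ} {rawAr rawBr : (ℕ → ℝ) → BgR → ℕ → E → ℂ} {ℓA ℓB : (ℕ → ℝ) → ℕ → Λ} {W : Set (ℕ → ℝ)}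
    {Lip Cℓ : ℝ} {rate : ℕ → ℝ} (hLip : 0 ≤ Lip)
    (hA : ∀ g ∈ W, ∀ b k e, rawAr g b k e = Φ k (ℓA g k) b e) (hB : ∀ g ∈ W, ∀ b k e, rawBr g b k e = Φ k (ℓB g k) b e)
    (hΦ : ∀ k ℓ ℓ' b e, ‖Φ k ℓ b e - Φ k ℓ' b e‖ ≤ Lip * dℓ ℓ ℓ' * (F k).wt e)
    (hℓ : ∀ k, ∀ g ∈ W, dℓ (ℓA g k) (ℓB g k) ≤ Cℓ * rate k) :
    WeightedEntrywiseRate F rawAr rawBr W (Lip * Cℓ) rate := by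
  intro k g hg b e
  rw [hA g hg b k e, hB g hg b k e]
  calc ‖Φ k (ℓA g k) b e - Φ k (ℓB g k) b e‖ ≤ Lip * dℓ (ℓA g k) (ℓB g k) * (F k).wt e := hΦ k _ _ b e
    _ ≤ Lip * (Cℓ * rate k) * (F k).wt e :=
      mul_le_mul_of_nonneg_right (mul_le_mul_of_nonneg_left (hℓ k g hg) hLip) ((F k).wt_pos e).le
    _ = Lip * Cℓ * rate k * (F k).wt e := by ring

/-- [folklore] **The same at the geometric rate `rate k = θ^k`** — EXACTLY the input `hwer` of
`OutputRateComplexSliceEntrywise.weightedEntrywiseRate_complex_of_record` (g36-c §3). -/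
theorem weightedEntrywiseRate_real_of_letters (F : ℕ → Format E) {BgR : Type} (dℓ : Λ → Λ → ℝ)
    {Φ : ℕ → Λ → BgR → E → ℂ} {rawAr rawBr : (ℕ → ℝ) → BgR → ℕ → E → ℂ} {ℓA ℓB : (ℕ → ℝ) → ℕ → Λ} {W : Set (ℕ → ℝ)}
    {Lip Cℓ θ : ℝ} (hLip : 0 ≤ Lip)
    (hA : ∀ g ∈ W, ∀ b k e, rawAr g b k e = Φ k (ℓA g k) b e) (hB : ∀ g ∈ W, ∀ b k e, rawBr g b k e = Φ k (ℓB g k) b e)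
    (hΦ : ∀ k ℓ ℓ' b e, ‖Φ k ℓ b e - Φ k ℓ' b e‖ ≤ Lip * dℓ ℓ ℓ' * (F k).wt e)
    (hℓ : ∀ k, ∀ g ∈ W, dℓ (ℓA g k) (ℓB g k) ≤ Cℓ * θ ^ k) :
    WeightedEntrywiseRate F rawAr rawBr W (Lip * Cℓ) fun k => θ ^ k :=
  weightedEntrywiseRate_real_of_letters_rate F dℓ hLip hA hB hΦ hℓ

/-- [folklore] **MIXED ENTRY SETS**: the entries in `S` are letter-driven (as above, readings stated for `e ∈ S` only), the remaining entries
carry a DISPLAYED rate `δ·rate k·wt e` (e.g. the pot readings of NE3's KIND, or image species); nonnegative `rate` ⟹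
`WeightedEntrywiseRate F rawAr rawBr W (max (Lip·C_ℓ) δ) rate`. -/
theorem weightedEntrywiseRate_real_of_letters_or_rate (F : ℕ → Format E) {BgR : Type} (dℓ : Λ → Λ → ℝ) (S : Set E)
    {Φ : ℕ → Λ → BgR → E → ℂ} {rawAr rawBr : (ℕ → ℝ) → BgR → ℕ → E → ℂ} {ℓA ℓB : (ℕ → ℝ) → ℕ → Λ} {W : Set (ℕ → ℝ)}
    {Lip Cℓ δ : ℝ} {rate : ℕ → ℝ} (hLip : 0 ≤ Lip) (hrate : ∀ k, 0 ≤ rate k)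
    (hA : ∀ g ∈ W, ∀ b k, ∀ e ∈ S, rawAr g b k e = Φ k (ℓA g k) b e)
    (hB : ∀ g ∈ W, ∀ b k, ∀ e ∈ S, rawBr g b k e = Φ k (ℓB g k) b e)
    (hΦ : ∀ k ℓ ℓ' b, ∀ e ∈ S, ‖Φ k ℓ b e - Φ k ℓ' b e‖ ≤ Lip * dℓ ℓ ℓ' * (F k).wt e)
    (hℓ : ∀ k, ∀ g ∈ W, dℓ (ℓA g k) (ℓB g k) ≤ Cℓ * rate k)
    (hrest : ∀ k, ∀ g ∈ W, ∀ b, ∀ e ∉ S, ‖rawAr g b k e - rawBr g b k e‖ ≤ δ * rate k * (F k).wt e) :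
    WeightedEntrywiseRate F rawAr rawBr W (max (Lip * Cℓ) δ) rate := by
  intro k g hg b e
  have hrw : 0 ≤ rate k * (F k).wt e := mul_nonneg (hrate k) ((F k).wt_pos e).le
  by_cases he : e ∈ S
  · rw [hA g hg b k e he, hB g hg b k e he]
    calc ‖Φ k (ℓA g k) b e - Φ k (ℓB g k) b e‖ ≤ Lip * dℓ (ℓA g k) (ℓB g k) * (F k).wt e := hΦ k _ _ b e he
      _ ≤ Lip * (Cℓ * rate k) * (F k).wt e :=
        mul_le_mul_of_nonneg_right (mul_le_mul_of_nonneg_left (hℓ k g hg) hLip) ((F k).wt_pos e).le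
      _ = Lip * Cℓ * (rate k * (F k).wt e) := by ring
      _ ≤ max (Lip * Cℓ) δ * (rate k * (F k).wt e) := mul_le_mul_of_nonneg_right (le_max_left _ _) hrw
      _ = max (Lip * Cℓ) δ * rate k * (F k).wt e := by ring
  · calc ‖rawAr g b k e - rawBr g b k e‖ ≤ δ * rate k * (F k).wt e := hrest k g hg b e he
      _ = δ * (rate k * (F k).wt e) := by ring
      _ ≤ max (Lip * Cℓ) δ * (rate k * (F k).wt e) := mul_le_mul_of_nonneg_right (le_max_right _ _) hrw
      _ = max (Lip * Cℓ) δ * rate k * (F k).wt e := by ring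

/-! ## §1b Where a letter rate comes from: the SAME step maps, contracting, from DIFFERENT initial letters -/

/-- [folklore] **LETTER RATE FROM A CONTRACTING LETTER RECURSION.**  If both runs' letter sequences obey the SAME step maps `f k` at aligned
steps (`hA`∕`hB`) — run B merely starts from a different initial letter (it has done one more step from its finer cutoff) — and every `f k` is a
`q`-contraction for the letter gauge `dℓ` (`q ≥ 0`), then the letters MERGE geometrically: `dℓ (ℓA k) (ℓB k) ≤ C₀·q^k` with `C₀` the initial
offset.  (The mechanism by which scheme constants forget the UV cutoff; which of Bałaban's constant recursions are of this kind is Q-S17 —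
nothing printed is asserted here.) -/
theorem letterRate_of_contraction (dℓ : Λ → Λ → ℝ) {f : ℕ → Λ → Λ} {ℓA ℓB : ℕ → Λ} {q C₀ : ℝ} (hq : 0 ≤ q)
    (hf : ∀ k x y, dℓ (f k x) (f k y) ≤ q * dℓ x y) (hA : ∀ k, ℓA (k + 1) = f k (ℓA k)) (hB : ∀ k, ℓB (k + 1) = f k (ℓB k))
    (h0 : dℓ (ℓA 0) (ℓB 0) ≤ C₀) : ∀ k, dℓ (ℓA k) (ℓB k) ≤ C₀ * q ^ k := by
  intro k
  induction k with
  | zero => simpa using h0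
  | succ k ih =>
      rw [hA k, hB k]
      calc dℓ (f k (ℓA k)) (f k (ℓB k)) ≤ q * dℓ (ℓA k) (ℓB k) := hf k _ _
        _ ≤ q * (C₀ * q ^ k) := mul_le_mul_of_nonneg_left ih hq
        _ = C₀ * q ^ (k + 1) := by ring

/-- [folklore] **The same in the shape of the binder `hℓ`** (coupling-indexed letter families; step maps, contraction modulus and initial offset
may depend on the coupling sequence `g ∈ W`, the offset bounded by ONE constant `C_ℓ` on the window). -/
theorem letterRate_of_contraction_on (dℓ : Λ → Λ → ℝ) {f : (ℕ → ℝ) → ℕ → Λ → Λ} {ℓA ℓB : (ℕ → ℝ) → ℕ → Λ} {W : Set (ℕ → ℝ)}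
    {q Cℓ : ℝ} (hq : 0 ≤ q) (hf : ∀ g ∈ W, ∀ k x y, dℓ (f g k x) (f g k y) ≤ q * dℓ x y)
    (hA : ∀ g ∈ W, ∀ k, ℓA g (k + 1) = f g k (ℓA g k)) (hB : ∀ g ∈ W, ∀ k, ℓB g (k + 1) = f g k (ℓB g k))
    (h0 : ∀ g ∈ W, dℓ (ℓA g 0) (ℓB g 0) ≤ Cℓ) : ∀ k, ∀ g ∈ W, dℓ (ℓA g k) (ℓB g k) ≤ Cℓ * q ^ k :=
  fun k g hg => letterRate_of_contraction dℓ hq (hf g hg) (hA g hg) (hB g hg) (h0 g hg) k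

/-! ## §2 The chain BY NAME: letters on the real window ⟹ the W1 binder of record over the recursion chart -/

/-- [folklore] **LETTERS ON THE REAL WINDOW + SLICE LETTERS ⟹ g36-c's CONCLUSION OVER THE RECURSION CHART.**  Hypotheses of
`OutputRateComplexSliceEntrywise.weightedEntrywiseRate_complex_of_record` VERBATIM except that `hwer` is REPLACED by the letter data of
`weightedEntrywiseRate_real_of_letters` (`Φ`, `dℓ`, `hAℓ`∕`hBℓ`, `hΦ`, `hℓ`) with `0 ≤ Lip·C_ℓ ≤ 2B` ⟹
`WeightedEntrywiseRate F rawA rawB W ((Lip·C_ℓ)^{1−λ}(2B)^{λ}) (k ↦ (θ^{1−λ})^k)` over the recursion chart `𝒰` and `RawBounded` of both runs,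
`λ = (2∕π)·arctan(2r∕(1−r²))`.  (The related window `BgR`, `ρ`, `emb` and the slices are the instance's letters — R52 (1).) -/
theorem weightedEntrywiseRate_complex_of_letters (F : ℕ → Format E) {BgR : Type} (dℓ : Λ → Λ → ℝ)
    {Φ : ℕ → Λ → BgR → E → ℂ} {ℓA ℓB : (ℕ → ℝ) → ℕ → Λ}
    {rawAr rawBr : (ℕ → ℝ) → BgR → ℕ → E → ℂ} {rawA rawB : (ℕ → ℝ) → 𝒰 → ℕ → E → ℂ}
    {KA KB : (ℕ → ℝ) → ℕ → 𝒱 → E → ℂ} (ρ : BgR → 𝒱) (emb : 𝒰 → 𝒱) {W : Set (ℕ → ℝ)} {Lip Cℓ θ B r : ℝ}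
    (hLip : 0 ≤ Lip) (hCℓ : 0 ≤ Cℓ) (hδB : Lip * Cℓ ≤ 2 * B) (hθ : 0 ≤ θ) (hθ1 : θ ≤ 1) (hr : r < 1)
    (hAℓ : ∀ g ∈ W, ∀ b k e, rawAr g b k e = Φ k (ℓA g k) b e) (hBℓ : ∀ g ∈ W, ∀ b k e, rawBr g b k e = Φ k (ℓB g k) b e)
    (hΦ : ∀ k ℓ ℓ' b e, ‖Φ k ℓ b e - Φ k ℓ' b e‖ ≤ Lip * dℓ ℓ ℓ' * (F k).wt e)
    (hℓ : ∀ k, ∀ g ∈ W, dℓ (ℓA g k) (ℓB g k) ≤ Cℓ * θ ^ k)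
    (hAr : ∀ g ∈ W, ∀ b k, rawAr g b k = KA g k (ρ b)) (hBr : ∀ g ∈ W, ∀ b k, rawBr g b k = KB g k (ρ b))
    (hA : ∀ g ∈ W, ∀ u k, rawA g u k = KA g k (emb u)) (hB : ∀ g ∈ W, ∀ u k, rawB g u k = KB g k (emb u))
    (hslice : ∀ k, ∀ g ∈ W, ∀ (u : 𝒰) (e : E), ∃ γ : ℂ → 𝒱, ∃ z₀ : ℂ, ‖z₀‖ ≤ r ∧ γ z₀ = emb u ∧
      (∀ x : ℝ, |x| < 1 → γ x ∈ Set.range ρ) ∧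
      DiffContOnCl ℂ (fun z => KA g k (γ z) e) (ball 0 1) ∧ DiffContOnCl ℂ (fun z => KB g k (γ z) e) (ball 0 1) ∧
        (∀ z : ℂ, ‖z‖ ≤ 1 → ‖KA g k (γ z) e‖ ≤ B * (F k).wt e) ∧ ∀ z : ℂ, ‖z‖ ≤ 1 → ‖KB g k (γ z) e‖ ≤ B * (F k).wt e) :
    WeightedEntrywiseRate F rawA rawB W
      ((Lip * Cℓ) ^ (1 - 2 / π * Real.arctan (2 * r / (1 - r ^ 2))) * (2 * B) ^ (2 / π * Real.arctan (2 * r / (1 - r ^ 2))))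
      (fun k => (θ ^ (1 - 2 / π * Real.arctan (2 * r / (1 - r ^ 2)))) ^ k) ∧
      RawBounded F rawA W ∧ RawBounded F rawB W :=
  weightedEntrywiseRate_complex_of_record F ρ emb (mul_nonneg hLip hCℓ) hδB hθ hθ1 hr hAr hBr hA hB
    (weightedEntrywiseRate_real_of_letters F dℓ hLip hAℓ hBℓ hΦ hℓ) hslice

/-! ## §3 R52 (2) as a kernel fact: independent pair coordinates admit no rate -/

/-- [folklore] **INDEPENDENT TWO-RUN PAIR COORDINATES ARE NOT A SOCKET.**  On the toy pair chart `ℝ × ℝ` (run A reads the first coordinate,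
run B the second) the level-constant families `oA g k v := v.1`, `oB g k v := v.2` are 1-Lipschitz in the background, AGREE on the related
diagonal `{(t, t)}` at every level (the two-run rate with `δ = 0`), and yet on the independent unit window `closedBall 0 1` there is NO pair
`(δ, θ)` with `θ < 1` and `‖oA g k v − oB g k v‖ ≤ δ·θ^k` for all `k` and `v` — the point `(1, 0)` keeps the difference `1` at every level
(`OutputRateComplexSliceWitness.no_rate_of_floor`).  So the `real`∕`hreal` socket of `OutputRateComplexSliceEnd` ∕ `…Entrywise` cannot be
inhabited on a window of independent pairs as soon as one species is non-constant in the background; the related window is forced (R52 (1)). -/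
theorem independentPairs_no_rate :
    ∃ oA oB : (ℕ → ℝ) → ℕ → ℝ × ℝ → ℝ,
      (∀ g k v v', ‖oA g k v - oA g k v'‖ ≤ ‖v - v'‖ ∧ ‖oB g k v - oB g k v'‖ ≤ ‖v - v'‖) ∧
      (∀ g k (t : ℝ), ‖oA g k (t, t) - oB g k (t, t)‖ ≤ 0 * (1 / 2 : ℝ) ^ k) ∧
      ∀ g, ¬ ∃ δ θ : ℝ, θ < 1 ∧ ∀ k : ℕ, ∀ v ∈ closedBall (0 : ℝ × ℝ) 1, ‖oA g k v - oB g k v‖ ≤ δ * θ ^ k := by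
  refine ⟨fun _ _ v => v.1, fun _ _ v => v.2, fun g k v v' => ⟨?_, ?_⟩, fun g k t => by simp, fun g => ?_⟩
  · simpa using norm_fst_le (v - v')
  · simpa using norm_snd_le (v - v')
  · rintro ⟨δ, θ, hθ, h⟩
    have hmem : ((1 : ℝ), (0 : ℝ)) ∈ closedBall (0 : ℝ × ℝ) 1 := by
      simp [Prod.norm_def]
    exact no_rate_of_floor (y := fun k : ℕ => ‖(1 : ℝ) - 0‖) (m := 1) one_pos (fun k => by simp)
      ⟨δ, θ, hθ, fun k => h k _ hmem⟩

end Summit.QuantumFields.BalabanUV.T4Continuum.OutputRateComplexSliceLetters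

end
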